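/- Companion file (pub-rosobs cell, carver generation 48, file 2).  Statement PUBLISHED
   (H. Matsumura, *Commutative Ring Theory*, §25 Exercise 25.5, for rings of characteristic `p`;
   the ring-general form with unit factorials is the finite-order part of the slice theorem for
   locally nilpotent derivations); formalisation OURS.  INSTRUMENT for the cell's normal-form
   bookkeeping (`Literature.AlgebraicGeometry.Resolution.WeightedCentreConstantField`, LEMMA CF (2)
   of engine 1 generation 32) — NOT a resolution theorem. -/
import Mathlib
import Literature.RingTheory.Derivation.HochschildFormula
import Literature.RingTheory.Derivation.MonogenicBasis
import Literature.RingTheory.Derivation.PClosedTaylor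
import HarnessLib

/-!
# A derivation with a slice: `A = ⊕_{i<N} A₀ · xⁱ` on elements of finite order

Topic: `Literature/RingTheory/Derivation`. Let `A` be a commutative `R`-algebra, `D` an
`R`-derivation of `A` and `x ∈ A` a **slice**, `D x = 1`; write `A₀ := ker D` for the ring of
constants. The companion file `PClosedTaylor` proves, for `A = K` a FIELD of characteristic `p` and
`D^[p] = 0`, that `K = ⊕_{i<p} K₀ · xⁱ` (Rudakov–Shafarevich / Jacobson). This file records the
same decomposition over an arbitrary commutative ring, which is the form used on polynomial rings:

* `eq_zero_of_sum_mul_pow_eq_zero_of_isUnit` (**uniqueness**): if `0!, …, (N-1)!` are units of `A`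
  and `∑_{i<N} cᵢ xⁱ = 0` with `D cᵢ = 0`, then all `cᵢ = 0` (apply `D^[N-1]` and induct; verbatim
  the field argument with "unit" for "non-zero");
* `exists_sum_mul_pow_of_iterate_eq_zero` (**existence**): under the same unit hypothesis every
  `a` with `D^[N] a = 0` is `∑_{i<N} cᵢ xⁱ` with `D cᵢ = 0` (induction on `N`: subtract
  `(N-1)!⁻¹ · D^[N-1] a · x^(N-1)`, whose top iterate is `D^[N-1] a` because `D^[N-1] x^(N-1) = (N-1)!`);
* `isUnit_cast_factorial_of_lt`: in characteristic `p` the factorials `n!`, `n < p`, are units of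
  ANY ring (they are units of `ZMod p`), so both apply with `N = p`;
* `existsUnique_fin_sum_mul_pow` (**Matsumura, Ex. 25.5**): if `A` has prime characteristic `p`,
  `D x = 1` and `D^[p] = 0`, then every `a ∈ A` is uniquely `∑_{i<p} cᵢ xⁱ` with `cᵢ ∈ A₀`, i.e.
  `A = A₀[x] = A₀ ⊕ A₀ x ⊕ ⋯ ⊕ A₀ x^(p-1)` (`fin_sum_mul_pow_eq_of_apply_eq_zero`: a constant is
  its own decomposition);
* `iteratePrime` / `iterate_prime_eq_zero_of_forall_X`: in characteristic `p` the iterate `D^[p]`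
  is a derivation (Leibniz rule from `HochschildFormula`), hence on a polynomial ring `k[X_σ]` it
  vanishes as soon as it vanishes on the generators; `existsUnique_fin_sum_mul_pow_mvPolynomial` is
  Matsumura's decomposition `k[X_σ] = (ker D)[x]` under `D x = 1`, `D^[p] (X i) = 0`.

Apart from the bundling `iteratePrime` everything is stated by explicit formulas, reusing
`derivation_iterate_pow_self` / `derivation_iterate_pow_of_lt` (`MonogenicBasis`),
`PClosed.iterate_apply_const_mul` / `PClosed.cast_factorial_ne_zero` (`PClosedTaylor`) and
`Hochschild.iterate_prime_apply_mul` (`HochschildFormula`).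

Use in the pub-rosobs cell (honest scope): for the degree-lowering derivation `Z = L_β` of a
maximal weighted centre with `Z(ε_{i₀}) = r ∈ kˣ` one takes `x = u = r⁻¹ ε_{i₀}`; when `Z` is
nilpotent of order `< p` on the generators, `Z^[p] = 0` and this file gives `k[ε_H] = (ker Z)[u]`,
the structural half of LEMMA CF (2) whose identity half (truncated exponential, chain rule,
`∂_{i₀} 𝒢 = 0 ⇒ p ∣ exponents`) is `…Resolution.WeightedCentreConstantField`. Nothing here concerns
centres, blow-ups or the resolution invariant.

References: H. Matsumura, *Commutative Ring Theory*, CUP 1986, §25 Exercise 25.5 (`A` of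
characteristic `p`, `D ∈ Der(A)`, `D^p = 0`, `Dx = 1` ⇒ `A = A₀[x] = A₀ + A₀x + ⋯ + A₀x^{p-1}` with
`1, x, …, x^{p-1}` independent over `A₀`); A. van den Essen, S. Kuroda, A. Crachiola, *Polynomial
Automorphisms and the Jacobian Conjecture: New Results from the Beginning of the 21st Century*,
Birkhäuser 2021, Ch. 3 §3.2, Cor. 3.2.10 (slice theorem `A = A^δ[s]`). Elementary; no named facts.
-/

open Finset
open scoped Nat

namespace Literature.RingTheory.Derivation

section Slice

variable {R A : Type*} [CommRing R] [CommRing A] [Algebra R A] (D : _root_.Derivation R A A)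

/-! ### Iterates are additive (`iterate_map_sub` is Mathlib's; sums are not) -/

/-- `D^[n] (∑ᵢ f i) = ∑ᵢ D^[n] (f i)` (the iterates of a derivation are additive; used in
Matsumura's exercise to read off the top coefficient). [cite: Matsumura1987, §25 Exercise 25.5 (iterates of a derivation are additive)] -/
theorem iterate_map_sum {ι : Type*} (s : Finset ι) (f : ι → A) (n : ℕ) :
    (⇑D)^[n] (∑ i ∈ s, f i) = ∑ i ∈ s, (⇑D)^[n] (f i) := by
  rw [derivation_iterate_eq_pow_apply, map_sum]
  exact sum_congr rfl fun i _ => (derivation_iterate_eq_pow_apply D n (f i)).symm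

/-! ### Uniqueness of the coefficients over the constants -/

/-- **Uniqueness** (ring form of `PClosed.eq_zero_of_sum_mul_pow_eq_zero`). If `D x = 1`, the
factorials `n!`, `n < N`, are units of `A`, and `∑_{i<N} cᵢ xⁱ = 0` with `D cᵢ = 0` for `i < N`,
then `cᵢ = 0` for all `i < N`: applying `D^[N-1]` kills `xⁱ`, `i < N - 1`, and sends `x^(N-1)` to
the unit `(N-1)!`; induct. (Matsumura, Ex. 25.5, independence of `1, x, …, x^{p-1}` over `A₀`;
formalisation ours.) [cite: Matsumura1987, §25 Exercise 25.5] -/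
theorem eq_zero_of_sum_mul_pow_eq_zero_of_isUnit {x : A} (hx : D x = 1) :
    ∀ N, (∀ n, n < N → IsUnit ((n ! : ℕ) : A)) → ∀ c : ℕ → A, (∀ i, i < N → D (c i) = 0) →
      ∑ i ∈ range N, c i * x ^ i = 0 → ∀ i, i < N → c i = 0 := by
  intro N
  induction N with
  | zero => intro _ _ _ _ i hi; omega
  | succ N ih =>
    intro hunit c hc hsum i hi
    have htop : c N = 0 := by
      have h1 := congr_arg (⇑D)^[N] hsum
      rw [iterate_map_zero, iterate_map_sum, sum_range_succ, sum_eq_zero, zero_add,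
        PClosed.iterate_apply_const_mul D (hc N (lt_add_one N)), derivation_iterate_pow_self D hx]
        at h1
      · exact (hunit N (lt_add_one N)).mul_right_eq_zero.mp
          ((mul_comm _ _).trans h1)
      · intro j hj
        have hjN : j < N := mem_range.1 hj
        rw [PClosed.iterate_apply_const_mul D (hc j (by omega)),
          derivation_iterate_pow_of_lt D hx hjN, mul_zero]
    rcases Nat.lt_succ_iff_lt_or_eq.1 hi with hi' | rfl
    · refine ih (fun n hn => hunit n (by omega)) c (fun j hj => hc j (by omega)) ?_ i hi'
      rw [sum_range_succ, htop, zero_mul, add_zero] at hsum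
      exact hsum
    · exact htop

/-! ### Existence on elements of finite order -/

/-- **Existence** (slice decomposition of an element of `D`-order `≤ N`). If `D x = 1`, the
factorials `n!`, `n < N`, are units of `A` and `D^[N] a = 0`, then `a = ∑_{i<N} cᵢ xⁱ` with
constants `cᵢ` (`D cᵢ = 0` for every `i`). Induction on `N`: with `d := D^[N-1] a ∈ A₀` the
element `a - (N-1)!⁻¹ d · x^(N-1)` has `D`-order `≤ N - 1`, because
`D^[N-1] (c · x^(N-1)) = c · (N-1)!` for a constant `c`. (Matsumura, Ex. 25.5, generation of `A`
by `1, x, …, x^{p-1}` over `A₀`; the finite-order part of the slice theorem; formalisation ours.)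
[cite: Matsumura1987, §25 Exercise 25.5]
[cite: VandenessenKurodaCrachiola2021, Ch. 3 §3.2 (Cor. 3.2.10)] -/
theorem exists_sum_mul_pow_of_iterate_eq_zero {x : A} (hx : D x = 1) :
    ∀ N, (∀ n, n < N → IsUnit ((n ! : ℕ) : A)) → ∀ a : A, (⇑D)^[N] a = 0 →
      ∃ c : ℕ → A, (∀ i, D (c i) = 0) ∧ a = ∑ i ∈ range N, c i * x ^ i := by
  classical
  intro N
  induction N with
  | zero =>
    intro _ a ha
    refine ⟨fun _ => 0, fun _ => map_zero D, ?_⟩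
    rw [Function.iterate_zero_apply] at ha
    rw [ha, sum_range_zero]
  | succ N ih =>
    intro hunit a ha
    obtain ⟨u, hu⟩ := hunit N (lt_add_one N)
    -- the top constant `d := D^[N] a` and the inverse `w` of `N!`
    have hd : D ((⇑D)^[N] a) = 0 := by
      rwa [Function.iterate_succ_apply'] at ha
    have hw : D (↑u⁻¹ : A) = 0 := by
      rw [D.leibniz_of_mul_eq_one (Units.inv_mul u), hu, Derivation.map_natCast, smul_zero]
    have hwd : D ((↑u⁻¹ : A) * (⇑D)^[N] a) = 0 := by
      rw [Derivation.leibniz, hd, hw, smul_zero, smul_zero, add_zero]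
    -- subtracting `w d · x^N` lowers the order
    have ha' : (⇑D)^[N] (a - (↑u⁻¹ : A) * (⇑D)^[N] a * x ^ N) = 0 := by
      rw [iterate_map_sub, mul_assoc, PClosed.iterate_apply_const_mul D hw,
        PClosed.iterate_apply_const_mul D hd, derivation_iterate_pow_self D hx, ← hu,
        mul_comm ((⇑D)^[N] a) (↑u : A), ← mul_assoc, Units.inv_mul, one_mul, sub_self]
    obtain ⟨c, hc, hca⟩ := ih (fun n hn => hunit n (Nat.lt_succ_of_lt hn)) _ ha'
    refine ⟨fun i => if i = N then (↑u⁻¹ : A) * (⇑D)^[N] a else c i, fun i => ?_, ?_⟩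
    · dsimp only
      by_cases hi : i = N
      · rw [if_pos hi, hwd]
      · rw [if_neg hi]
        exact hc i
    · dsimp only
      rw [sum_range_succ, if_pos rfl,
        sum_congr rfl fun i hi => by rw [if_neg (by have := mem_range.1 hi; omega)], ← hca,
        sub_add_cancel]

/-! ### Characteristic `p`: factorials below `p` are units of any ring -/

/-- In a ring of prime characteristic `p` the factorials `n!`, `n < p`, are units (they are
non-zero in the field `ZMod p`, which maps to `A`) — the divisibility fact that makes Matsumura's
exercise work over any ring of characteristic `p`, not only over fields.
[cite: Matsumura1987, §25 Exercise 25.5 (factorials below p are invertible in characteristic p)] -/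
theorem isUnit_cast_factorial_of_lt (p : ℕ) [hp : Fact p.Prime] [CharP A p] {n : ℕ}
    (hn : n < p) : IsUnit ((n ! : ℕ) : A) := by
  have h : IsUnit ((n ! : ℕ) : ZMod p) :=
    (PClosed.cast_factorial_ne_zero (K := ZMod p) hp.out hn).isUnit
  simpa only [map_natCast] using h.map (ZMod.castHom (dvd_refl p) A)

/-- **Matsumura, Ex. 25.5 (slice decomposition in characteristic `p`).** Let `A` be a
commutative ring of prime characteristic `p`, `D` a derivation of `A` with `D^[p] = 0` and
`x ∈ A` with `D x = 1`; `A₀ := ker D`. Then `A = A₀[x] = A₀ ⊕ A₀ x ⊕ ⋯ ⊕ A₀ x^(p-1)`: every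
`a ∈ A` is `∑_{i<p} cᵢ xⁱ` for a unique family of constants `(cᵢ)_{i<p}`. (Statement
published; formalisation ours.) [cite: Matsumura1987, §25 Exercise 25.5] -/
theorem existsUnique_fin_sum_mul_pow (p : ℕ) [hp : Fact p.Prime] [CharP A p] {x : A}
    (hx : D x = 1) (hDp : ∀ a, (⇑D)^[p] a = 0) (a : A) :
    ∃! c : Fin p → A, (∀ i, D (c i) = 0) ∧ a = ∑ i, c i * x ^ (i : ℕ) := by
  classical
  have hunit : ∀ n, n < p → IsUnit ((n ! : ℕ) : A) := fun n hn =>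
    isUnit_cast_factorial_of_lt (A := A) p hn
  obtain ⟨c, hc, hca⟩ := exists_sum_mul_pow_of_iterate_eq_zero D hx p hunit a (hDp a)
  refine ⟨fun i => c i, ⟨fun i => hc i, ?_⟩, ?_⟩
  · rw [Fin.sum_univ_eq_sum_range (fun i => c i * x ^ i) p]
    exact hca
  · rintro c' ⟨hc', hca'⟩
    funext i
    -- apply uniqueness to the difference of the two coefficient families
    let δ : ℕ → A := fun j => if h : j < p then c' ⟨j, h⟩ - c j else 0
    have hδ : ∀ j, j < p → D (δ j) = 0 := fun j hj => by
      simp only [δ, dif_pos hj, map_sub, hc', hc, sub_zero]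
    have hsum : ∑ j ∈ range p, δ j * x ^ j = 0 := by
      have h1 : ∑ j ∈ range p, δ j * x ^ j =
          ∑ i : Fin p, c' i * x ^ (i : ℕ) - ∑ i : Fin p, c i * x ^ (i : ℕ) := by
        rw [← Fin.sum_univ_eq_sum_range (fun j => δ j * x ^ j) p, ← sum_sub_distrib]
        refine sum_congr rfl fun i _ => ?_
        simp only [δ, dif_pos i.2, Fin.eta, sub_mul]
      rw [h1, ← hca', Fin.sum_univ_eq_sum_range (fun i => c i * x ^ i) p, ← hca, sub_self]
    have key := eq_zero_of_sum_mul_pow_eq_zero_of_isUnit D hx p hunit δ hδ hsum i i.2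
    simp only [δ, dif_pos i.2, Fin.eta] at key
    exact (sub_eq_zero.mp key)

/-- **Corollary.** Under the hypotheses of Matsumura's exercise the coefficient family of a
constant `a` (`D a = 0`) is `(a, 0, …, 0)`. [cite: Matsumura1987, §25 Exercise 25.5] -/
theorem fin_sum_mul_pow_eq_of_apply_eq_zero (p : ℕ) [hp : Fact p.Prime] [CharP A p] {x : A}
    (hx : D x = 1) (hDp : ∀ a, (⇑D)^[p] a = 0) {a : A} (ha : D a = 0) {c : Fin p → A}
    (hc : ∀ i, D (c i) = 0) (hca : a = ∑ i, c i * x ^ (i : ℕ)) (i : Fin p) :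
    c i = if (i : ℕ) = 0 then a else 0 := by
  classical
  let c₀ : Fin p → A := fun i => if (i : ℕ) = 0 then a else 0
  have hc₀ : (∀ i, D (c₀ i) = 0) ∧ a = ∑ i, c₀ i * x ^ (i : ℕ) := by
    refine ⟨fun i => ?_, ?_⟩
    · by_cases hi : (i : ℕ) = 0
      · simp only [c₀, if_pos hi, ha]
      · simp only [c₀, if_neg hi, map_zero]
    · rw [Finset.sum_eq_single (⟨0, hp.out.pos⟩ : Fin p)]
      · simp [c₀]
      · intro j _ hj
        have : (j : ℕ) ≠ 0 := fun h => hj (Fin.ext h)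
        simp only [c₀, if_neg this, zero_mul]
      · intro h
        exact absurd (mem_univ _) h
  have huniq := (existsUnique_fin_sum_mul_pow D p hx hDp a).unique ⟨hc, hca⟩ hc₀
  rw [huniq]

/-! ### Characteristic `p`: the `p`-th iterate is a derivation; vanishing on generators -/

/-- **The `p`-th power of a derivation in characteristic `p`** is again a derivation (Leibniz
rule for `D^[p]`: the middle binomial coefficients vanish, `Hochschild.iterate_prime_apply_mul`),
bundled. (Matsumura, §25, restricted Lie algebra structure on `Der_k(A)`; formalisation ours.)
[cite: Matsumura1987, §25 (p-th powers of derivations; Thm. 25.5)] -/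
def iteratePrime (p : ℕ) [hp : Fact p.Prime] [CharP A p] : _root_.Derivation R A A :=
  _root_.Derivation.mk' ((D : A →ₗ[R] A) ^ p) fun a b => by
    rw [← derivation_iterate_eq_pow_apply, ← derivation_iterate_eq_pow_apply,
      ← derivation_iterate_eq_pow_apply, Hochschild.iterate_prime_apply_mul hp.out D a b,
      smul_eq_mul, smul_eq_mul]

/-- The bundled `p`-th power acts as the `p`-th iterate: `iteratePrime D p a = D^[p] a`.
[cite: Matsumura1987, §25 (p-th powers of derivations; Thm. 25.5)] -/
@[simp]
theorem iteratePrime_apply (p : ℕ) [Fact p.Prime] [CharP A p] (a : A) :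
    iteratePrime D p a = (⇑D)^[p] a := by
  rw [derivation_iterate_eq_pow_apply]
  rfl

/-- **`D^[p] = 0` is decided on generators.** For a derivation `D` of a polynomial ring
`k[X_σ]`, `k` of prime characteristic `p`: if `D^[p] (X i) = 0` for every `i` (e.g. `D` nilpotent
of order `< p` on each generator), then `D^[p] = 0` — because `D^[p]` is a derivation
(`iteratePrime`) and a derivation of `k[X_σ]` vanishing on the `X i` is zero. This is the form in
which the hypothesis `D^p = 0` of Matsumura's exercise is met by the degree-lowering derivations of
the pub-rosobs cell. [cite: Matsumura1987, §25 Exercise 25.5] -/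
theorem iterate_prime_eq_zero_of_forall_X {σ k : Type*} [CommRing k] (p : ℕ) [Fact p.Prime]
    [CharP k p] (D : _root_.Derivation k (MvPolynomial σ k) (MvPolynomial σ k))
    (h : ∀ i, (⇑D)^[p] (MvPolynomial.X i) = 0) (f : MvPolynomial σ k) : (⇑D)^[p] f = 0 := by
  have hD : iteratePrime D p = 0 :=
    MvPolynomial.derivation_ext fun i => by rw [iteratePrime_apply, h i, Derivation.zero_apply]
  rw [← iteratePrime_apply D p f, hD, Derivation.zero_apply]

/-- **Slice decomposition of a polynomial ring** (Matsumura, Ex. 25.5, applied). For a derivation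
`D` of `k[X_σ]`, `char k = p`, with a slice `D x = 1` and `D^[p] (X i) = 0` for all `i`, every
polynomial is uniquely `∑_{i<p} cᵢ xⁱ` with `D cᵢ = 0`: `k[X_σ] = (ker D)[x]`, free on
`1, x, …, x^(p-1)`. [cite: Matsumura1987, §25 Exercise 25.5] -/
theorem existsUnique_fin_sum_mul_pow_mvPolynomial {σ k : Type*} [CommRing k] (p : ℕ)
    [Fact p.Prime] [CharP k p] (D : _root_.Derivation k (MvPolynomial σ k) (MvPolynomial σ k))
    {x : MvPolynomial σ k} (hx : D x = 1) (h : ∀ i, (⇑D)^[p] (MvPolynomial.X i) = 0)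
    (f : MvPolynomial σ k) :
    ∃! c : Fin p → MvPolynomial σ k, (∀ i, D (c i) = 0) ∧ f = ∑ i, c i * x ^ (i : ℕ) :=
  existsUnique_fin_sum_mul_pow D p hx (iterate_prime_eq_zero_of_forall_X p D h) f

end Slice

end Literature.RingTheory.Derivation
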